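import Mathlib
import Literature.Analysis.FluidPDE.Tao2016AveragedNS.ViscousEnvelopeSmoothing
import Summits.NavierStokesRegularity.NavierStokesRegularity.Theorems.SubcriticalEnvelopeForwardSourceTailEnvelope.Negative.ForwardSourceTailEnvelopeFalseOfSideBranchEscapeSmallRatio
import Summits.NavierStokesRegularity.NavierStokesRegularity.Theorems.SubOnsagerCeilingOrthantTailCeiling.Negative.OrthantTailCeilingFalseOfSideBranchEscapeEstimate
import HarnessLib

/-!
# `SubcriticalEnvelope.ForwardSourceTailEnvelope` (stmt-NavierStokesRegularity-26373) — negative lemma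
modulo the A PRIORI escape ESTIMATE at small ratio (`SideBranchEscapeEstimateSmallRatio`), the
existence half discharged (second file of the Negative directory; `--negative-modulo`)

`ForwardSourceTailEnvelopeFalseOfSideBranchEscapeSmallRatio.lean` (p623621) refutes the crux AS TYPED
modulo `SideBranchEscapeSmallRatio` = ns-soc-p2's `SideBranchEscapeAt ε₀` at arbitrarily small `ε₀`,
a hypothesis which POSITS escaping solutions (an existence clause).  ns-soc-p2 g3 has since split
the existence half off for 25507 (`OrthantTailCeilingFalseOfSideBranchEscapeEstimate.lean`, p627307):
`SideBranchEscapeEstimateAt ε₀` is UNIVERSALLY quantified over honest window solutions («every regular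
solution has lost ρE₀ from the block 0..K by time s ≤ T₀»), and under the ceiling the envelope engine
supplies the solutions.  The same upgrade works for 26373: the twin reduction
(`forwardSourceTailEnvelope_imp_totalEnvelope_sideBranch`) gives the ν-uniform WINDOW envelope on
`α_SB`, which is (i) exactly the hypothesis of the landed smoothing engine
`exists_viscousGlobal_of_subcriticalEnvelope_of_inTableClass` — so GLOBAL REGULAR α_SB solutions exist
at every viscosity — and (ii) incompatible with escape (`sideBranch_not_escape_of_windowEnvelope`).

* `sideBranch_viscousGlobal_of_windowEnvelope` — window envelope at `ε₀` ⇒ `ViscousGlobal` α_SB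
  solutions for every `ν > 0` and every datum;
* `sideBranchEscapeAt_of_windowEnvelope_of_estimate` — window envelope ∧ `SideBranchEscapeEstimateAt ε₀`
  ⇒ `SideBranchEscapeAt ε₀` (clamp the global solution to the estimate's window, `viscousGlobal_window`);
* `SideBranchEscapeEstimateSmallRatio` (`Prop`, NOTHING asserted): the estimate at arbitrarily small
  ratio, `∀ ε̄ ∈ (0,1] ∃ ε₀ ∈ (0,ε̄], SideBranchEscapeEstimateAt ε₀`; implies `SideBranchEscapeEstimate`;
* **`forwardSourceTailEnvelope_false_of_sideBranchEscapeEstimateSmallRatio :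
    SideBranchEscapeEstimateSmallRatio → ¬ForwardSourceTailEnvelope`**, and the same for the aside
  A‴ (`viscousTailEnvelope_false_of_sideBranchEscapeEstimateSmallRatio`).

So 25507 / 26608 (through ns-ow-p1's reduction) / 26373 / 26128 are refuted in the kernel modulo ONE
universally-quantified a priori estimate family on the explicit 3-mode table `α_SB`.

HONEST FRAMING: conditional refutations about Tao-type MODEL lattice ODEs (rung TL-M2Break); the
hypothesis is a numerics-backed ESTIMATE (REFUTATION-EVIDENCE-25507 §5, kit j302483), not a theorem and
not a published fact; nothing is refuted unconditionally; nothing here concerns the Navier–Stokes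
equations; NS regularity is NOT advanced.
-/

noncomputable section

-- the sub-problem namespace `NavierStokesRegularity.NavierStokesRegularity` is the tree's layout (D-0017)
set_option linter.dupNamespace false

namespace Summit.NavierStokesRegularity.NavierStokesRegularity.Theorems

open Set
open Literature.Analysis.FluidPDE.TaoCascade
open Summit.NavierStokesRegularity.NavierStokesRegularity.Theorems.SubOnsagerCeiling
open Summit.NavierStokesRegularity.NavierStokesRegularity.Theses

/-- **Window envelope ⇒ global regular viscous α_SB solutions at every viscosity** (the existence
half, free): the ν-uniform window-wise total-energy envelope on `sideBranchTable` at scale ratio `1+ε₀`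
(VERBATIM the conclusion of `forwardSourceTailEnvelope_imp_totalEnvelope_sideBranch` at `ε₀`) is,
at each fixed `ν`, the hypothesis of the landed smoothing engine
`exists_viscousGlobal_of_subcriticalEnvelope_of_inTableClass` (`α_SB ∈ E₂(10)`).  MODEL lattice.
[this file] -/
theorem sideBranch_viscousGlobal_of_windowEnvelope {ε₀ : ℝ} (hε : 0 < ε₀)
    (henv : ∀ X₀ : Fin 4 → ℝ, ∃ η : ℝ, 0 < η ∧
      ∀ T : ℝ, 0 < T → ∃ C : ℝ, ∀ ν : ℝ, 0 < ν → ∀ s ∈ Set.Ioc (0 : ℝ) T,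
      ∀ X : Fin 4 → ℤ → ℝ → ℝ,
      (∀ i k, X i k 0 = if k = 0 then X₀ i else 0) →
      (∀ i k, k < 0 → ∀ t, X i k t = 0) →
      (∃ M : ℝ, ∀ (t : ℝ) (i : Fin 4) (k : ℤ), (1 + (1 + ε₀) ^ ((10 : ℝ) * k)) * |X i k t| ≤ M) →
      (∀ i k, Continuous (X i k)) →
      (∀ i k, ∀ t ∈ Set.Icc (0 : ℝ) s, HasDerivWithinAt (X i k)
        (quadTerm ε₀ sideBranchTable X i k t - ν * (1 + ε₀) ^ ((2 : ℝ) * k) * X i k t)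
        (Set.Icc 0 s) t) →
      ∀ n N : ℕ, n ≤ N → ∀ t ∈ Set.Icc (0 : ℝ) s,
        ∑ k ∈ Finset.Icc n N, ∑ i, (1 / 2) * X i (k : ℤ) t ^ 2 ≤
          C * (1 + ε₀) ^ (-((1 + η) * (n : ℝ))))
    (ν : ℝ) (hν : 0 < ν) (X₀ : Fin 4 → ℝ) :
    ∃ X : Fin 4 → ℤ → ℝ → ℝ, ViscousGlobal ε₀ ν sideBranchTable X₀ X := by
  obtain ⟨η, hη, HT⟩ := henv X₀
  exact exists_viscousGlobal_of_subcriticalEnvelope_of_inTableClass hε.le hη hν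
    sideBranchTable_inTableClass X₀ (fun T hT => by
      obtain ⟨C, hC⟩ := HT T hT
      exact ⟨C, fun s hs X hinit hlow hbd hcont hder => hC ν hν s hs X hinit hlow hbd hcont hder⟩)

/-- **Window envelope ∧ a priori escape estimate ⇒ escaping solutions** (`SideBranchEscapeAt ε₀`):
take the global regular solution at a viscosity below both thresholds and clamp it to the estimate's
window (`viscousGlobal_window`).  MODEL lattice. [this file] -/
theorem sideBranchEscapeAt_of_windowEnvelope_of_estimate {ε₀ : ℝ} (hε : 0 < ε₀)
    (henv : ∀ X₀ : Fin 4 → ℝ, ∃ η : ℝ, 0 < η ∧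
      ∀ T : ℝ, 0 < T → ∃ C : ℝ, ∀ ν : ℝ, 0 < ν → ∀ s ∈ Set.Ioc (0 : ℝ) T,
      ∀ X : Fin 4 → ℤ → ℝ → ℝ,
      (∀ i k, X i k 0 = if k = 0 then X₀ i else 0) →
      (∀ i k, k < 0 → ∀ t, X i k t = 0) →
      (∃ M : ℝ, ∀ (t : ℝ) (i : Fin 4) (k : ℤ), (1 + (1 + ε₀) ^ ((10 : ℝ) * k)) * |X i k t| ≤ M) →
      (∀ i k, Continuous (X i k)) →
      (∀ i k, ∀ t ∈ Set.Icc (0 : ℝ) s, HasDerivWithinAt (X i k)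
        (quadTerm ε₀ sideBranchTable X i k t - ν * (1 + ε₀) ^ ((2 : ℝ) * k) * X i k t)
        (Set.Icc 0 s) t) →
      ∀ n N : ℕ, n ≤ N → ∀ t ∈ Set.Icc (0 : ℝ) s,
        ∑ k ∈ Finset.Icc n N, ∑ i, (1 / 2) * X i (k : ℤ) t ^ 2 ≤
          C * (1 + ε₀) ^ (-((1 + η) * (n : ℝ))))
    (hE : SideBranchEscapeEstimateAt ε₀) : SideBranchEscapeAt ε₀ := by
  obtain ⟨ρ, hρ, T₀, hT₀, X₀, hE₀, hK⟩ := hE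
  refine ⟨ρ, hρ, T₀, hT₀, X₀, hE₀, fun K ν₀ hν₀ => ?_⟩
  obtain ⟨ν₁, hν₁, hν⟩ := hK K
  set ν : ℝ := min ν₀ ν₁ with hνdef
  have hνpos : 0 < ν := lt_min hν₀ hν₁
  obtain ⟨s, hs, hsT, hall⟩ := hν ν hνpos (min_le_right _ _)
  obtain ⟨X, hX⟩ := sideBranch_viscousGlobal_of_windowEnvelope hε henv ν hνpos X₀
  obtain ⟨hinit, hlow, hbd, hcont, hder⟩ := viscousGlobal_window hX hs
  set Xc : Fin 4 → ℤ → ℝ → ℝ := fun i k t => X i k (max 0 (min t s)) with hXc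
  have hloss := hall Xc hinit hlow hbd hcont hder
  exact ⟨ν, hνpos, min_le_left _ _, s, hs, hsT, Xc, hinit, hlow, hbd, hcont, hder, hloss⟩

/-- **`SideBranchEscapeEstimateSmallRatio` — the a priori escape estimate at ARBITRARILY SMALL scale
ratio**: `∀ ε̄ ∈ (0,1] ∃ ε₀ ∈ (0,ε̄], SideBranchEscapeEstimateAt ε₀` (ns-soc-p2's universally
quantified estimate: every honest `ν`-viscous α_SB solution from the datum loses the fraction `ρ` of
its energy from every block `0..K` within a fixed time, for `ν` below a depth-dependent threshold).
A `Prop`; NOTHING asserted; numerics-backed (REFUTATION-EVIDENCE-25507 §5, kit j302483), extrapolated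
in `ε₀` and `K`; a CONSTRUCTION/ESTIMATE TARGET, not a published fact. [this file] -/
def SideBranchEscapeEstimateSmallRatio : Prop :=
  ∀ εbar : ℝ, 0 < εbar → εbar ≤ 1 → ∃ ε₀ : ℝ, 0 < ε₀ ∧ ε₀ ≤ εbar ∧ SideBranchEscapeEstimateAt ε₀

/-- The small-ratio estimate implies ns-soc-p2's `SideBranchEscapeEstimate` (SOME ratio `≤ 1`), hence
`¬OrthantTailCeiling` by `orthantTailCeiling_false_of_sideBranchEscapeEstimate`. [this file] -/
theorem sideBranchEscapeEstimate_of_smallRatio (h : SideBranchEscapeEstimateSmallRatio) :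
    SideBranchEscapeEstimate := by
  obtain ⟨ε₀, hε₀, hle, hE⟩ := h 1 one_pos le_rfl
  exact ⟨ε₀, hε₀, hle, hE⟩

/-- **NEGATIVE LEMMA modulo the A PRIORI ESTIMATE (existence half discharged)**:
`SideBranchEscapeEstimateSmallRatio → ¬ForwardSourceTailEnvelope`.  Chain: A⁺ ⇒ `εs` and the window
envelope on `α_SB` at every `ε₀ ≤ εs` (twin reduction) ⇒ at the estimate's `ε₀ ≤ min εs 1`: global
regular solutions at every `ν` (engine) ⇒ escaping solutions (estimate, clamped) ⇒ contradiction with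
`sideBranch_not_escape_of_windowEnvelope`.  MODEL lattice only; conditional; settles nothing by
itself. [this file] -/
theorem forwardSourceTailEnvelope_false_of_sideBranchEscapeEstimateSmallRatio
    (h : SideBranchEscapeEstimateSmallRatio) : ¬ SubcriticalEnvelope.ForwardSourceTailEnvelope := by
  intro hA
  obtain ⟨εs, hεs, Henv⟩ := forwardSourceTailEnvelope_imp_totalEnvelope_sideBranch hA
  obtain ⟨ε₀, hε₀, hle, hE⟩ := h (min εs 1) (lt_min hεs one_pos) (min_le_right _ _)
  have henv := Henv ε₀ hε₀ (hle.trans (min_le_left _ _))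
  exact sideBranch_not_escape_of_windowEnvelope hε₀ henv
    (sideBranchEscapeAt_of_windowEnvelope_of_estimate hε₀ henv hE)

/-- **The same for the aside A‴ = `ViscousTailEnvelope` (stmt-26128)**, through A‴ ⇒ A⁺.
MODEL lattice only; conditional. [this file] -/
theorem viscousTailEnvelope_false_of_sideBranchEscapeEstimateSmallRatio
    (h : SideBranchEscapeEstimateSmallRatio) : ¬ SubcriticalEnvelope.ViscousTailEnvelope :=
  fun hA => forwardSourceTailEnvelope_false_of_sideBranchEscapeEstimateSmallRatio h
    (forwardSourceTailEnvelope_of_viscousTailEnvelope hA)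

end Summit.NavierStokesRegularity.NavierStokesRegularity.Theorems

end
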